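import Mathlib
import Summits.RiemannHypothesis.RiemannHypothesis.Theorems.SoloBlindDeepPair

/-!
# Moment-blind crowds: visibility of a deep pair behind any on-line crowd of fixed width
(soloist `solo-RiemannHypothesis-blind`, artefact 14; report `paper/window-height.md` §11.7,
THEOREM D9 (i), kernel form)

Setting (artefacts 11–13): the zero-side Weil functional of a configuration of zeros, evaluated at
a test function `g ∈ L²` supported in the window `(-a, a]`, is the sum over the configuration of
`H(ρ) · conj H(ρ̄')`-type terms with `H(z) = ∫ g(x) e^{izx} dx`.  For the configuration
`Z₁(δ) ∪ crowd` — the on-line lattice `sℤ` with the site `0` replaced by the off-line pair `∓iδ`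
(artefact 12, `soloBlind_deepPair_hasSum`, value
`(2π/s)‖g‖² − |H(0)|² + 2 Re(H(−iδ) conj H(iδ))`) plus finitely many ON-LINE zeros `v_k ∈ [-u, u]`
with multiplicities `m_k ≥ 0` (the *crowd*, contributing `Σ m_k |H(v_k)|²`) — we prove:

* `soloBlind_fourier_moment_bound`: if `g` is orthogonal to the monomials `x^k`, `k < J`, then
  every crowd point sees at most the Taylor remainder of `e^{ivx}`:
  `|H(v)| ≤ 2 (u a)^J / J! · ‖g‖₁` for `|v| ≤ u` (given `u a ≤ (J+1)/2`).  The crowd is blind to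
  such a detector up to `U^J/J!`, `U = u a`, WHATEVER the positions and multiplicities.
* `soloBlind_momentDetector_visible`: consequently, for an ODD such `g` the functional of
  `Z₁(δ) ∪ crowd` is `≤ (2π/s)‖g‖² − 2|∫ g e^{δx}|² + (Σ m_k)(2U^J/J!)²‖g‖₁²`, and it is NEGATIVE —
  the pair is VISIBLE — as soon as the displayed inequality `hvis` holds.  With
  `g = sinh(δx) −` (its Legendre projection of degree `< J`) this is THEOREM D9 (i) of the report
  (fixed-width crowding is at most `(1+o(1)) log m/(e log log m)`); the choice of `g` and the
  evaluation of `‖g‖`, `∫ g sinh` are left to the report (special functions), the mechanism —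
  moment-orthogonality makes a confined crowd blind — is what is certified here.

Mathlib only; the Taylor remainder is `Complex.exp_bound'` (hence the harmless factor 2 and the
side condition `u a/(J+1) ≤ 1/2`).
-/

open MeasureTheory Complex Set Finset
open scoped Real ComplexConjugate

namespace Summit.RiemannHypothesis.RiemannHypothesis.Theorems

/-- Integrability of `g · w` for an integrable `g` supported in `(-a, a]` and a continuous complex
weight `w` (bounded on the compact window). -/
theorem soloBlind_integrable_mul_cweight {g : ℝ → ℂ} {a : ℝ} (hgi : Integrable g)
    (hsupp : Function.support g ⊆ Ioc (-a) a) {w : ℝ → ℂ} (hw : Continuous w) :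
    Integrable (fun x => g x * w x) := by
  obtain ⟨W, hW⟩ := (isCompact_Icc (a := -a) (b := a)).exists_bound_of_continuousOn hw.continuousOn
  have hbound : ∀ x, ‖g x * w x‖ ≤ W * ‖g x‖ := by
    intro x
    by_cases hx : g x = 0
    · simp [hx]
    · have hxI : x ∈ Icc (-a) a := Ioc_subset_Icc_self (hsupp hx)
      rw [norm_mul, mul_comm]
      exact mul_le_mul_of_nonneg_right (hW x hxI) (norm_nonneg _)
  exact (hgi.norm.const_mul W).mono' (hgi.aestronglyMeasurable.mul hw.aestronglyMeasurable)
    (Filter.Eventually.of_forall hbound)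

/-- **A crowd inside `[-u, u]` is blind, up to the Taylor remainder, to a detector orthogonal to the
monomials of degree `< J`.**  For `g` integrable, supported in `(-a, a]`, with
`∫ g(x) x^k dx = 0` for all `k < J`, and `u a/(J+1) ≤ 1/2`:
`|∫ g(x) e^{ivx} dx| ≤ 2 (u a)^J / J! · ∫ |g|` for every real `v` with `|v| ≤ u`. -/
theorem soloBlind_fourier_moment_bound (a u : ℝ) (hu : 0 ≤ u) (J : ℕ)
    (hJ : u * a / (J + 1) ≤ 1 / 2) {g : ℝ → ℂ} (hgi : Integrable g)
    (hsupp : Function.support g ⊆ Ioc (-a) a)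
    (horth : ∀ k < J, ∫ x : ℝ, g x * (x : ℂ) ^ k = 0) (v : ℝ) (hv : |v| ≤ u) :
    ‖∫ x : ℝ, g x * cexp (I * (v : ℂ) * (x : ℂ))‖
      ≤ 2 * (u * a) ^ J / J.factorial * ∫ x : ℝ, ‖g x‖ := by
  set R : ℝ → ℂ := fun x =>
    cexp (I * (v : ℂ) * (x : ℂ)) - ∑ k ∈ range J, (I * (v : ℂ) * (x : ℂ)) ^ k / (k.factorial : ℂ)
    with hR
  -- continuity of the weights
  have hc_exp : Continuous fun x : ℝ => cexp (I * (v : ℂ) * (x : ℂ)) := by fun_prop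
  have hc_mon : ∀ k : ℕ, Continuous fun x : ℝ => (I * (v : ℂ) * (x : ℂ)) ^ k / (k.factorial : ℂ) := by
    intro k; fun_prop
  have hc_sum : Continuous fun x : ℝ =>
      ∑ k ∈ range J, (I * (v : ℂ) * (x : ℂ)) ^ k / (k.factorial : ℂ) :=
    continuous_finsetSum _ (fun k _ => hc_mon k)
  -- Step 1: the Taylor polynomial of `e^{ivx}` integrates to zero against `g`
  have hpoly : ∫ x : ℝ, g x * ∑ k ∈ range J, (I * (v : ℂ) * (x : ℂ)) ^ k / (k.factorial : ℂ) = 0 := by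
    have hterm : ∀ k ∈ range J,
        Integrable (fun x : ℝ => g x * ((I * (v : ℂ) * (x : ℂ)) ^ k / (k.factorial : ℂ))) :=
      fun k _ => soloBlind_integrable_mul_cweight hgi hsupp (hc_mon k)
    calc ∫ x : ℝ, g x * ∑ k ∈ range J, (I * (v : ℂ) * (x : ℂ)) ^ k / (k.factorial : ℂ)
        = ∫ x : ℝ, ∑ k ∈ range J, g x * ((I * (v : ℂ) * (x : ℂ)) ^ k / (k.factorial : ℂ)) := by
          congr 1; funext x; rw [Finset.mul_sum]
      _ = ∑ k ∈ range J, ∫ x : ℝ, g x * ((I * (v : ℂ) * (x : ℂ)) ^ k / (k.factorial : ℂ)) :=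
          integral_finsetSum _ hterm
      _ = ∑ k ∈ range J, ((I * (v : ℂ)) ^ k / (k.factorial : ℂ)) * ∫ x : ℝ, g x * (x : ℂ) ^ k := by
          refine Finset.sum_congr rfl fun k _ => ?_
          rw [← integral_const_mul]
          congr 1; funext x
          rw [mul_pow]
          ring
      _ = 0 := by
          refine Finset.sum_eq_zero fun k hk => ?_
          rw [horth k (Finset.mem_range.mp hk), mul_zero]
  have hexp_i : Integrable (fun x : ℝ => g x * cexp (I * (v : ℂ) * (x : ℂ))) :=
    soloBlind_integrable_mul_cweight hgi hsupp hc_exp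
  have hsum_i : Integrable (fun x : ℝ =>
      g x * ∑ k ∈ range J, (I * (v : ℂ) * (x : ℂ)) ^ k / (k.factorial : ℂ)) :=
    soloBlind_integrable_mul_cweight hgi hsupp hc_sum
  have hkey : (∫ x : ℝ, g x * cexp (I * (v : ℂ) * (x : ℂ))) = ∫ x : ℝ, g x * R x := by
    have hfun : (fun x => g x * R x) = fun x =>
        g x * cexp (I * (v : ℂ) * (x : ℂ))
          - g x * ∑ k ∈ range J, (I * (v : ℂ) * (x : ℂ)) ^ k / (k.factorial : ℂ) := by
      funext x; simp only [hR]; ring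
    rw [hfun, integral_sub hexp_i hsum_i, hpoly, sub_zero]
  -- Step 2: pointwise Taylor remainder on the window (`Complex.exp_bound'`)
  set C : ℝ := 2 * (u * a) ^ J / J.factorial with hC
  have hpt : ∀ x, ‖g x * R x‖ ≤ ‖g x‖ * C := by
    intro x
    by_cases hx : g x = 0
    · simp [hx]
    · have hxI : x ∈ Icc (-a) a := Ioc_subset_Icc_self (hsupp hx)
      have hxa : |x| ≤ a := abs_le.mpr ⟨by linarith [hxI.1], hxI.2⟩
      have hz : ‖I * (v : ℂ) * (x : ℂ)‖ ≤ u * a := by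
        rw [norm_mul, norm_mul, Complex.norm_I, one_mul, Complex.norm_real, Complex.norm_real,
          Real.norm_eq_abs, Real.norm_eq_abs]
        exact mul_le_mul hv hxa (abs_nonneg _) hu
      have hz' : ‖I * (v : ℂ) * (x : ℂ)‖ / ((J.succ : ℕ) : ℝ) ≤ 1 / 2 := by
        rw [Nat.cast_succ]
        exact le_trans (by gcongr) hJ
      have hRb : ‖R x‖ ≤ ‖I * (v : ℂ) * (x : ℂ)‖ ^ J / J.factorial * 2 :=
        Complex.exp_bound' hz'
      rw [norm_mul]
      refine mul_le_mul_of_nonneg_left ?_ (norm_nonneg _)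
      calc ‖R x‖ ≤ ‖I * (v : ℂ) * (x : ℂ)‖ ^ J / J.factorial * 2 := hRb
        _ ≤ (u * a) ^ J / J.factorial * 2 := by gcongr
        _ = C := by rw [hC]; ring
  rw [hkey]
  calc ‖∫ x : ℝ, g x * R x‖ ≤ ∫ x : ℝ, ‖g x‖ * C :=
        norm_integral_le_of_norm_le (hgi.norm.mul_const C) (Filter.Eventually.of_forall hpt)
    _ = C * ∫ x : ℝ, ‖g x‖ := by rw [integral_mul_const, mul_comm]

/-- For an ODD test function the two transforms of the pair are opposite and `H(0) = 0`. -/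
theorem soloBlind_odd_pair_transforms (δ : ℝ) {g : ℝ → ℂ} (hodd : ∀ x, g (-x) = -g x) :
    (∫ x : ℝ, g x * cexp (I * (((0 : ℝ) : ℂ)) * (x : ℂ))) = 0 ∧
    (∫ x : ℝ, g x * cexp (I * (((0 : ℝ) : ℂ) + I * δ) * (x : ℂ)))
      = -(∫ x : ℝ, g x * cexp (I * (((0 : ℝ) : ℂ) - I * δ) * (x : ℂ))) := by
  constructor
  · have h1 : (∫ x : ℝ, g x * cexp (I * (((0 : ℝ) : ℂ)) * (x : ℂ))) = ∫ x, g x := by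
      congr 1; funext x; simp
    have h2 := integral_neg_eq_self g volume
    have h3 : (∫ x : ℝ, g (-x)) = -∫ x : ℝ, g x := by
      rw [← integral_neg]; congr 1; funext x; exact hodd x
    rw [h1]
    have h4 : (∫ x : ℝ, g x) = -∫ x : ℝ, g x := h2.symm.trans h3
    linear_combination (1 / 2 : ℂ) * h4
  · have h := integral_neg_eq_self
      (fun x : ℝ => g x * cexp (I * (((0 : ℝ) : ℂ) - I * δ) * (x : ℂ))) volume
    rw [← h, ← integral_neg]
    congr 1; funext x
    rw [hodd x, Complex.ofReal_neg,
      show I * (((0 : ℝ) : ℂ) - I * δ) * (-(x : ℂ)) = I * (((0 : ℝ) : ℂ) + I * δ) * (x : ℂ) by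
        push_cast; ring]
    ring

/-- **Visibility behind a moment-blind crowd (THEOREM D9 (i) of the report, kernel form).**
Configuration: `Z₁(δ)` (on-line lattice `sℤ`, site `0` replaced by the pair `∓iδ`; artefact 12 with
`u₀ = 0`, window `(-a, a]`, `2a ≤ 2π/s`) together with a crowd of on-line zeros `v_k`, `k ∈ t`,
`|v_k| ≤ u`, multiplicities `m_k ≥ 0`.  Test function: `g ∈ L²`, supported in `(-a, a]`, ODD, and
orthogonal to `x^k` for `k < J` (`u a/(J+1) ≤ 1/2`).  If
`(2π/s)‖g‖² + (Σ m_k)·(2(ua)^J/J!)²·‖g‖₁² < 2|∫ g(x) e^{δx} dx|²`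
then the zero-side functional of `Z₁(δ) ∪ crowd` at `g` is NEGATIVE: the pair is visible, whatever
the positions and multiplicities of the crowd inside `[-u, u]`. -/
theorem soloBlind_momentDetector_visible (s δ a u : ℝ) (hs : 0 < s) (hu : 0 ≤ u)
    (haT : 2 * a ≤ 2 * π / s) (J : ℕ) (hJ : u * a / (J + 1) ≤ 1 / 2)
    {ι : Type*} (t : Finset ι) (v m : ι → ℝ) (hm : ∀ k ∈ t, 0 ≤ m k) (hv : ∀ k ∈ t, |v k| ≤ u)
    {g : ℝ → ℂ} (hg : MemLp g 2 volume) (hsupp : Function.support g ⊆ Ioc (-a) a)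
    (hodd : ∀ x, g (-x) = -g x) (horth : ∀ k < J, ∫ x : ℝ, g x * (x : ℂ) ^ k = 0)
    (hvis : (2 * π / s) * (∫ x : ℝ, ‖g x‖ ^ 2)
        + (∑ k ∈ t, m k) * (2 * (u * a) ^ J / J.factorial) ^ 2 * (∫ x : ℝ, ‖g x‖) ^ 2
        < 2 * ‖∫ x : ℝ, g x * cexp (I * (((0 : ℝ) : ℂ) - I * δ) * (x : ℂ))‖ ^ 2) :
    (∑' j : ℤ, (if j = 0 then
        2 * ((∫ x : ℝ, g x * cexp (I * (((0 : ℝ) : ℂ) - I * δ) * (x : ℂ))) *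
            conj ((∫ x : ℝ, g x * cexp (I * (((0 : ℝ) : ℂ) + I * δ) * (x : ℂ))))).re
      else ‖(∫ x : ℝ, g x * cexp (I * ((((0 : ℝ) + j * s : ℝ) : ℂ)) * (x : ℂ)))‖ ^ 2))
      + ∑ k ∈ t, m k * ‖∫ x : ℝ, g x * cexp (I * ((v k : ℝ) : ℂ) * (x : ℂ))‖ ^ 2 < 0 := by
  -- integrability from `L²` and bounded support
  have hgi : Integrable g := by
    have hm2 : MemLp g 2 (volume.restrict (Ioc (-a) a)) := hg.restrict _
    haveI : IsFiniteMeasure (volume.restrict (Ioc (-a) a)) :=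
      isFiniteMeasure_restrict.mpr (by simp [Real.volume_Ioc])
    have h1 : IntegrableOn g (Ioc (-a) a) := hm2.integrable one_le_two
    exact (integrableOn_iff_integrable_of_support_subset hsupp).mp h1
  -- the lattice-with-pair part (artefact 12) and its value for odd `g`
  have hsupp' : Function.support g ⊆ Ioc (-a) (-a + 2 * π / s) :=
    hsupp.trans (Ioc_subset_Ioc_right (by linarith))
  have hsum := soloBlind_deepPair_hasSum (-a) s 0 δ hs hg hsupp'
  obtain ⟨h0, hplus⟩ := soloBlind_odd_pair_transforms δ hodd
  have hre : ∀ A : ℂ, 2 * (A * conj (-A)).re = -2 * ‖A‖ ^ 2 := by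
    intro A
    simp only [map_neg, mul_neg, Complex.neg_re, Complex.mul_re, Complex.conj_re,
      Complex.conj_im, Complex.sq_norm, Complex.normSq_apply]
    ring
  have hval : (∑' j : ℤ, (if j = 0 then
        2 * ((∫ x : ℝ, g x * cexp (I * (((0 : ℝ) : ℂ) - I * δ) * (x : ℂ))) *
            conj ((∫ x : ℝ, g x * cexp (I * (((0 : ℝ) : ℂ) + I * δ) * (x : ℂ))))).re
      else ‖(∫ x : ℝ, g x * cexp (I * ((((0 : ℝ) + j * s : ℝ) : ℂ)) * (x : ℂ)))‖ ^ 2))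
      = (2 * π / s) * (∫ x : ℝ, ‖g x‖ ^ 2)
        - 2 * ‖∫ x : ℝ, g x * cexp (I * (((0 : ℝ) : ℂ) - I * δ) * (x : ℂ))‖ ^ 2 := by
    rw [hsum.tsum_eq, h0, hplus, norm_zero, hre]
    ring
  -- the crowd part: each point sees at most the Taylor remainder
  set C : ℝ := 2 * (u * a) ^ J / J.factorial with hC
  have hcrowd : ∑ k ∈ t, m k * ‖∫ x : ℝ, g x * cexp (I * ((v k : ℝ) : ℂ) * (x : ℂ))‖ ^ 2
      ≤ (∑ k ∈ t, m k) * C ^ 2 * (∫ x : ℝ, ‖g x‖) ^ 2 := by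
    rw [Finset.sum_mul, Finset.sum_mul]
    refine Finset.sum_le_sum fun k hk => ?_
    have hb := soloBlind_fourier_moment_bound a u hu J hJ hgi hsupp horth (v k) (hv k hk)
    have hsq : ‖∫ x : ℝ, g x * cexp (I * ((v k : ℝ) : ℂ) * (x : ℂ))‖ ^ 2
        ≤ (C * ∫ x : ℝ, ‖g x‖) ^ 2 := pow_le_pow_left₀ (norm_nonneg _) hb 2
    calc m k * ‖∫ x : ℝ, g x * cexp (I * ((v k : ℝ) : ℂ) * (x : ℂ))‖ ^ 2
        ≤ m k * (C * ∫ x : ℝ, ‖g x‖) ^ 2 := mul_le_mul_of_nonneg_left hsq (hm k hk)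
      _ = m k * C ^ 2 * (∫ x : ℝ, ‖g x‖) ^ 2 := by ring
  rw [hval]
  linarith [hcrowd, hvis]

end Summit.RiemannHypothesis.RiemannHypothesis.Theorems
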